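import Summits.RiemannHypothesis.RiemannHypothesis.Theorems.PfPersistenceF1AnalyticTwin

/-!
# PF persistence, fake seat 1 — one analytic twin gives a continuum (FAKES §1.9, remark (r2))

Unit `pub-rhpf-fake-1` of the `pub-rhpf` cell (mechanism / rigidity campaign; **no RH claims**).

`PfPersistenceF1AnalyticTwin` typed THEOREM F1-U in two forms: `AnalyticNonRigidityWeak` (some
analytic twin of `μZ` below depth `U` differs from `μZ`) and `AnalyticNonRigidity` (an uncountable set
of twins avoiding `μZ`).  Here the two are PROVED EQUIVALENT (`analyticNonRigidity_iff_weak`): the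
analytic half `AnalyticBLExt U μZ` is convex, the segment `t ↦ t•μ + (1−t)•μZ` from `μZ` to a twin
`μ ≠ μZ` stays inside it for `t ∈ [0, 1]`, and it is injective there because two distinct even tempered
measures already differ on a set of finite mass (`exists_measurableSet_ne_of_ne`), while `(0, 1]` is
uncountable (`Cardinal.mk_Ioc_real`).  Elementary measure theory; nothing about `ζ` is asserted.
-/

set_option linter.dupNamespace false

noncomputable section

open MeasureTheory Set Complex
open scoped ENNReal

namespace Summit.RiemannHypothesis.RiemannHypothesis.Theorems.PfPersistence.Fake1.AnalyticTwin

open Summit.RiemannHypothesis.RiemannHypothesis.Theorems.PfPersistenceBarrier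
open Summit.RiemannHypothesis.RiemannHypothesis.Theorems.PfPersistence.Fake1
open Summit.RiemannHypothesis.RiemannHypothesis.Theorems.PfPersistence.Fake1.BLExt

/-! ## One twin gives a continuum (PROVED): the weak and the uncountable forms of F1-U agree -/

/-- Two even tempered measures that differ, differ on a set where both are finite. [folklore] -/
theorem exists_measurableSet_ne_of_ne {μ μ' : Measure ℝ} (hμ : IsEvenTempered μ) (hμ' : IsEvenTempered μ')
    (hne : μ ≠ μ') : ∃ A : Set ℝ, MeasurableSet A ∧ μ A ≠ ⊤ ∧ μ' A ≠ ⊤ ∧ μ A ≠ μ' A := by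
  by_contra h
  push Not at h
  obtain ⟨-, C, N, hgr⟩ := hμ
  obtain ⟨-, C', N', hgr'⟩ := hμ'
  have hunion : (⋃ n : ℕ, Icc (-(n : ℝ)) n) = univ := by
    refine eq_univ_of_forall fun x => ?_
    obtain ⟨n, hn⟩ := exists_nat_ge |x|
    exact mem_iUnion.2 ⟨n, abs_le.mp hn⟩
  refine hne ((Measure.ext_iff_of_iUnion_eq_univ hunion).2 fun n => ?_)
  ext A hA
  rw [Measure.restrict_apply hA, Measure.restrict_apply hA]
  have hn : (0 : ℝ) ≤ n := n.cast_nonneg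
  refine h _ (hA.inter measurableSet_Icc) ?_ ?_
  · exact ((measure_mono inter_subset_right).trans_lt (lt_top_iff_ne_top.2 (hgr n hn).1)).ne
  · exact ((measure_mono inter_subset_right).trans_lt (lt_top_iff_ne_top.2 (hgr' n hn).1)).ne

/-- The SEGMENT from `μZ` (at `t = 0`) to `μ` (at `t = 1`). [folklore] -/
def segment (μZ μ : Measure ℝ) (t : ℝ) : Measure ℝ :=
  ENNReal.ofReal t • μ + ENNReal.ofReal (1 - t) • μZ

/-- The segment starts at `μZ`. [folklore] -/
theorem segment_zero (μZ μ : Measure ℝ) : segment μZ μ 0 = μZ := by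
  simp [segment]

/-- Evaluation of the segment on a set. [folklore] -/
theorem segment_apply (μZ μ : Measure ℝ) (t : ℝ) (A : Set ℝ) :
    segment μZ μ t A = ENNReal.ofReal t * μ A + ENNReal.ofReal (1 - t) * μZ A := by
  simp [segment, Measure.add_apply, Measure.smul_apply, smul_eq_mul]

/-- Points of the segment with parameter in `[0, 1]` are analytic twins whenever the endpoints are.
[folklore] -/
theorem segment_mem_analyticBLExt {μZ μ : Measure ℝ} {U : ℝ} (hZ : μZ ∈ AnalyticBLExt U μZ)
    (hμ : μ ∈ AnalyticBLExt U μZ) {t : ℝ} (ht0 : 0 ≤ t) (ht1 : t ≤ 1) :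
    segment μZ μ t ∈ AnalyticBLExt U μZ := by
  refine convexComb_mem_analyticBLExt hμ hZ ENNReal.ofReal_ne_top ENNReal.ofReal_ne_top ?_
  rw [← ENNReal.ofReal_add ht0 (sub_nonneg.2 ht1), add_sub_cancel, ENNReal.ofReal_one]

/-- The segment is injective on `[0, 1]` as soon as its endpoints are distinct even tempered measures.
[folklore] -/
theorem segment_injOn {μZ μ : Measure ℝ} (hZ : IsEvenTempered μZ) (hμ : IsEvenTempered μ)
    (hne : μ ≠ μZ) : InjOn (segment μZ μ) (Icc 0 1) := by
  obtain ⟨A, -, hμA, hZA, hA⟩ := exists_measurableSet_ne_of_ne hμ hZ hne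
  intro t₁ ht₁ t₂ ht₂ h
  have h' := congrArg (fun ν : Measure ℝ => (ν A).toReal) h
  simp only [segment_apply] at h'
  have key : ∀ t ∈ Icc (0 : ℝ) 1,
      (ENNReal.ofReal t * μ A + ENNReal.ofReal (1 - t) * μZ A).toReal =
        t * (μ A).toReal + (1 - t) * (μZ A).toReal := by
    intro t ht
    rw [ENNReal.toReal_add (ENNReal.mul_ne_top ENNReal.ofReal_ne_top hμA)
        (ENNReal.mul_ne_top ENNReal.ofReal_ne_top hZA),
      ENNReal.toReal_mul, ENNReal.toReal_mul, ENNReal.toReal_ofReal ht.1,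
      ENNReal.toReal_ofReal (sub_nonneg.2 ht.2)]
  rw [key t₁ ht₁, key t₂ ht₂] at h'
  have hA' : (μ A).toReal ≠ (μZ A).toReal := fun h'' => hA ((ENNReal.toReal_eq_toReal_iff' hμA hZA).1 h'')
  have : (t₁ - t₂) * ((μ A).toReal - (μZ A).toReal) = 0 := by linarith
  rcases mul_eq_zero.1 this with h0 | h0
  · linarith
  · exact absurd (sub_eq_zero.1 h0) hA'

/-- **One twin gives a continuum**: the weak form of F1-U implies the uncountable form (segments from
`μZ` to a twin `μ ≠ μZ` stay in the convex set `AnalyticBLExt U μZ` and are injective). [folklore] -/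
theorem analyticNonRigidity_of_weak (h : AnalyticNonRigidityWeak) : AnalyticNonRigidity := by
  intro U hU μZ hZ
  obtain ⟨μ, hμ, hne⟩ := h U hU μZ hZ
  have hZmem : μZ ∈ AnalyticBLExt U μZ := self_mem_analyticBLExt hZ U
  have hinj : InjOn (segment μZ μ) (Icc 0 1) := segment_injOn hZmem.1 hμ.1 hne
  refine ⟨segment μZ μ '' Ioc 0 1, ?_, ?_, ?_⟩
  · rintro _ ⟨t, ht, rfl⟩
    exact segment_mem_analyticBLExt hZmem hμ ht.1.le ht.2
  · intro hcount
    have hIoc : (Ioc (0 : ℝ) 1).Countable :=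
      countable_of_injective_of_countable_image (hinj.mono Ioc_subset_Icc_self) hcount
    have h1 : Cardinal.mk (Ioc (0 : ℝ) 1) ≤ Cardinal.aleph0 :=
      Cardinal.mk_le_aleph0_iff.2 hIoc.to_subtype
    rw [Cardinal.mk_Ioc_real zero_lt_one] at h1
    exact (not_le.2 Cardinal.aleph0_lt_continuum) h1
  · rintro ⟨t, ht, hteq⟩
    have h0 : segment μZ μ t = segment μZ μ 0 := by rw [hteq, segment_zero]
    have := hinj (Ioc_subset_Icc_self ht) (left_mem_Icc.2 zero_le_one) h0
    exact ht.1.ne' this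

/-- The two typed forms of THEOREM F1-U are equivalent. [folklore] -/
theorem analyticNonRigidity_iff_weak : AnalyticNonRigidity ↔ AnalyticNonRigidityWeak :=
  ⟨analyticNonRigidityWeak_of_analyticNonRigidity, analyticNonRigidity_of_weak⟩

end Summit.RiemannHypothesis.RiemannHypothesis.Theorems.PfPersistence.Fake1.AnalyticTwin
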